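import Literature.IUT.HodgeArakelov.AbsTopMonoidsGenuineAtModelTate
import Literature.IUT.HodgeArakelov.GaloisPairRigidityRmk1111bGenuine
import Literature.IUT.HodgeArakelov.GaloisPairRigidityProp34iiStrongGenuine
import Literature.IUT.HodgeArakelov.GaloisPairRigidityRmk1112iGenuine
import Literature.IUT.HodgeArakelov.TemperedThetaMonoidsCor37GenuineProofs
import HarnessLib

/-!
# The Galois-pair-rigidity chain of [IUTchII] §1/§3/§4 AT THE STAGE-2 TATE MODEL — UNCONDITIONAL at the all-fields-genuine
# producer (K-L6 row «GPR-CHAIN@modelTate», proof-only)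

S. Mochizuki, *Inter-universal Teichmüller theory II*, §1 Example 1.8 (ii)–(iv) (kurims pp. 35–39), Remark 1.11.1 (i)
(pp. 49–50), Remark 1.11.2 (i) (pp. 50–51), Remark 1.8.1 (pp. 41–42), §3 Proposition 3.4 (ii) (pp. 92–93),
Corollary 3.7 (ii) (p. 112), §4 Proposition 4.2 (i) (p. 124) [claim: Mochizuki2012, status: disputed].

Cell `abc-iut`, seat abc-iut-L6-d2 (gen 9), K-L6 row «GPR-CHAIN@modelTate» (abc-iut-L6-lead L6 ROWS #3), sequel of this seat's
`AbsTopMonoidsGenuineAtModelTate` (p489543).  PROOF-ONLY (no definitions, no instances, no named facts).  The tree's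
«UNCONDITIONAL at the fully genuine producer `genuineOfModelIsm S C ε hΔ hq`» theorems of the Galois-pair-rigidity chain
(abc-iut-L6-t13 / abc-iut-L6-d2 / abc-iut-w6-d010 / abc-iut-w6-d020 lineages: `genuineOfModelIsm_continuityLaws`,
`genuineOfModelIsm_isTMPair`, `genuineOfModelIsm_isTMPairMTM`, `genuineOfModelIsm_isOfMonoAnalyticType`,
`rmk1111_a_genuineOfModelIsm`, `rmk1111_b_genuineOfModelIsm`, `rmk1111_d_genuineOfModelIsm`, `rmk181_genuineOfModelIsm`,
`prop42i_genuineOfModelIsm`, `prop34iiStrong_genuineOfModelIsm`, `cor37ii_uniradialContent_genuineOfModelIsm`,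
`rmk1112_i_genuineOfModelIsm`) carry exactly the producer's two binders (H1) `hΔ` / (H2) `hq`.  At the [IUTchII] §1 setting
`S := ThetaSetting.ofDoubleUnderline C μ …` of ANY `X̲̲`-choice `C` over the stage-2 Tate model
`ThetaSetting.modelχq p i j` both are THEOREMS (p489543: `hΔ :=` abc-iut-w4-d044's
`deltaX_characteristic_ofDoubleUnderline_modelχq_of_ker_ne_bot'` ∘ `ker_tatePairHom_ne_bot`,
`hq := nonempty_quotDeltaX_iso_ofDoubleUnderline_modelχq`), so the whole chain holds there with NO residual binder, at ONE
producer — the explicit `genuineOfModelIsm S (mlfClosurePadic) (galoisEpsilonPadic) hΔ hq`: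
* `exists_allGenuine_gprChain_ofDoubleUnderlinePadic_modelχq` — ∃ `A : AbsTopMonoids S`, all-fields-genuine (`O^⊳(G)` genuine,
  `Ism(G)` = print's isometry group), with continuity laws `hcl`, `IsTMPair`/`IsTMPairMTM`/mono-analytic type at every `G`/`Π`,
  `Rmk1111_a`, `Rmk1111_d`, `Rmk181_statement`, Prop. 4.2 (i) over every
  `f : G ⥲ H`, the STRONG Prop. 3.4 (ii) (junction J13) at every `G`, and the Cor. 3.7 (ii) uniradiality content at every
  `G`-equivariant model of the unit group;
* `rmk1111_b_genuineOfModelIsm_modelχq`, `rmk1112_i_genuineOfModelIsm_modelχq(')` — Rmk. 1.11.1 (i) (b) and Rmk. 1.11.2 (i)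
  at the EXPLICIT producer (their extra data are typed on the genuine units; the `Fact residueChar.Prime` instance is
  `MLFClosure.fact_residueChar_prime`).

HONEST FRAMING: `modelχq` is a SEMI-SYNTHETIC model (binder-discharge / joint-satisfiability evidence for OUR typed interface,
not the tempered `π₁` of a curve); tree theorems only; nothing here bears on [IUTchIII] Cor. 3.12 or takes a side; typed ≠
proved elsewhere; instantiated ≠ endorsed; nothing asserts abc proved or refuted.
-/

set_option autoImplicit false

noncomputable section

namespace Literature.IUT.HodgeArakelov

open Literature.AnabelianGeometry.AbsoluteAnabelian
open Literature.AnabelianGeometry.EtaleTheta Literature.AnabelianGeometry.SemiGraphs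
open Literature.AnabelianGeometry.EtaleTheta.SettingModel
open scoped Literature.AnabelianGeometry.EtaleTheta

namespace AbsTopMonoids

variable (p : ℕ) [Fact p.Prime] (i j : ℤ) (hj : Even j)
  {ED : (Literature.AnabelianGeometry.EtaleTheta.ThetaSetting.modelχq p i j hj).EtaleThetaData} {l : ℕ}
  (C : ED.DoubleUnderline l) {N : ℕ+}
  (μ : (Literature.AnabelianGeometry.EtaleTheta.ThetaSetting.modelχq p i j hj).CyclotomeMod l N)
  (hC : (Literature.AnabelianGeometry.EtaleTheta.ThetaSetting.modelχq p i j hj).Compat)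
  (hS : (Literature.AnabelianGeometry.EtaleTheta.ThetaSetting.modelχq p i j hj).Sec2Hyps)
  (hl : l.Prime) (hp2 : p ≠ 2) (hpl : p ≠ l)
  (hζ : ∃ ζ : (Literature.AnabelianGeometry.EtaleTheta.ThetaSetting.modelχq p i j hj).K, IsPrimitiveRoot ζ (4 * l))
  {η : (C.thetaEnvData μ hC hS).PiYdd → MuN p N} (hη : η ∈ (C.thetaEnvData μ hC hS).thetaCocycles)

/-- **The Galois-pair-rigidity chain at the Tate model, UNCONDITIONALLY, at ONE all-fields-genuine producer**: for every
`X̲̲`-choice `C` over `modelχq p i j` there is an `AbsTopMonoids` at `S = ofDoubleUnderline C μ …` over `(K, ℚ̄_p, ε = id)` with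
`O^⊳(G) = 𝒪^⊳_{ℚ̄_p}`, `Ism(G)` = print's isometry group, continuity laws `hcl`, and: `IsTMPair hcl G`, `IsTMPairMTM hcl Π`,
mono-analytic type of the pair at every `G` (Ex. 1.8 (ii)); `Rmk1111_a` / `Rmk1111_d` (Rmk. 1.11.1 (i) (a)(d); (b) is
`rmk1111_b_genuineOfModelIsm_modelχq` below, at the explicit producer, since its `zhatPow` datum is typed on the genuine units); `Rmk181_statement` (Rmk. 1.8.1); `GoodPrimeKummer.Prop42i` over every `f : G ⥲ H`
(Prop. 4.2 (i)); the STRONG Prop. 3.4 (ii) (J13: a `G`-equivariant automorphism `ψ` of `O^{×μ}(G)` induced by a pair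
automorphism of `G ↷ O^×(G)` over `1` and by NO pair automorphism of `G ↷ O^⊳(G)`); and the Cor. 3.7 (ii) uniradiality
content at every `G`-equivariant model `U` of the unit group — witness `genuineOfModelIsm S mlfClosurePadic galoisEpsilonPadic
hΔ hq` with `hΔ`, `hq` the theorems of p489543. [claim: Mochizuki2012, status: disputed] (IUTchII §3 Prop 3.4 (ii), kurims pp.92-93) -/
theorem exists_allGenuine_gprChain_ofDoubleUnderlinePadic_modelχq :
    ∃ A : AbsTopMonoids (ThetaSetting.ofDoubleUnderline C μ hC hS hl hp2 hpl hζ hη),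
      (∀ G, A.Otri G =
        (ModelMLFGaloisData.galois
          (Literature.AnabelianGeometry.EtaleTheta.ThetaSetting.modelχq p i j hj).toTemperedCurve.mlfClosurePadic.k
          (Literature.AnabelianGeometry.EtaleTheta.ThetaSetting.modelχq p i j hj).toTemperedCurve.mlfClosurePadic.K).tmPair.M) ∧
      (∀ G, A.Ism G = ↥(A.ism G)) ∧
      ∃ hcl : A.ContinuityLaws,
        (∀ G, A.IsTMPair hcl G) ∧
        (∀ P, A.IsTMPairMTM hcl P) ∧
        (∀ G, IsOfMonoAnalyticTypeMonoid .TM (A.toPair hcl G)) ∧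
        Rmk1111_a A ∧
        Rmk1111_d A ∧
        Rmk181_statement A ∧
        (∀ {G H : IsoClass (ThetaSetting.ofDoubleUnderline C μ hC hS hl hp2 hpl hζ hη).Gk} (f : G ⟶ H),
          GoodPrimeKummer.Prop42i (A.toPair hcl G) (A.toPair hcl H) (IsoClass.homIso f)) ∧
        (∀ G : IsoClass (ThetaSetting.ofDoubleUnderline C μ hC hS hl hp2 hpl hζ hη).Gk,
          ∃ ψ : MulAut (A.Oxmu G),
            (∀ (g : G.G) (x : A.Oxmu G), ψ (A.actOxmu G g x) = A.actOxmu G g (ψ x)) ∧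
            (∃ q : PairAut G (A.Ounits G) (A.actOunits G),
                PairAut.forget q = 1 ∧
                ∀ x : A.Ounits G, (QuotientGroup.mk (q.1.2 x) : A.Oxmu G) = ψ (QuotientGroup.mk x)) ∧
            ∀ q : PairAut G (A.Otri G) (A.actOtri G),
                ∃ x : A.Ounits G,
                  (QuotientGroup.mk (Units.map q.1.2.toMonoidHom x) : A.Oxmu G) ≠ ψ (QuotientGroup.mk x)) ∧
        (∀ (G : IsoClass (ThetaSetting.ofDoubleUnderline C μ hC hS hl hp2 hpl hζ hη).Gk) {U : Type} [CommGroup U]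
            (act : G.G →* MulAut U) (ιU : A.Ounits G ≃* U)
            (_hι : ∀ (g : G.G) (x : A.Ounits G), ιU (A.actOunits G g x) = act g (ιU x)),
          ∃ ψ : MulAut (U ⧸ CommGroup.torsion U),
            (∀ actμ : G.G → (U ⧸ CommGroup.torsion U →* U ⧸ CommGroup.torsion U),
                (∀ (g : G.G) (x : U), actμ g (QuotientGroup.mk x) = QuotientGroup.mk (act g x)) →
                ∀ (g : G.G) (y : U ⧸ CommGroup.torsion U), ψ (actμ g y) = actμ g (ψ y)) ∧
            (∃ q : PairAut G U act, PairAut.forget q = 1 ∧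
                ∀ x : U, (QuotientGroup.mk (q.1.2 x) : U ⧸ CommGroup.torsion U) = ψ (QuotientGroup.mk x)) ∧
            ∀ q : PairAut G (A.Otri G) (A.actOtri G),
                PairAut.forget q = 1 →
                ∃ x : A.Ounits G,
                  (QuotientGroup.mk (ιU (Units.map q.1.2.toMonoidHom x)) : U ⧸ CommGroup.torsion U) ≠
                    ψ (QuotientGroup.mk (ιU x))) := by
  have hq := nonempty_quotDeltaX_iso_ofDoubleUnderline_modelχq p i j hj C μ hC hS hl hp2 hpl hζ hη
  have hΔ := deltaX_characteristic_ofDoubleUnderline_modelχq_of_ker_ne_bot' p i j hj C μ hC hS hl hp2 hpl hζ hη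
    (ker_tatePairHom_ne_bot p i j)
  refine ⟨genuineOfModelIsm (ThetaSetting.ofDoubleUnderline C μ hC hS hl hp2 hpl hζ hη)
      (Literature.AnabelianGeometry.EtaleTheta.ThetaSetting.modelχq p i j hj).toTemperedCurve.mlfClosurePadic
      (Literature.AnabelianGeometry.EtaleTheta.ThetaSetting.modelχq p i j hj).toTemperedCurve.galoisEpsilonPadic hΔ hq,
    fun _ => rfl, fun _ => rfl, genuineOfModelIsm_continuityLaws _ _ _ hΔ hq, ?_⟩
  exact ⟨fun G => genuineOfModelIsm_isTMPair _ _ _ hΔ hq G,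
    fun P => genuineOfModelIsm_isTMPairMTM _ _ _ hΔ hq P,
    fun G => genuineOfModelIsm_isOfMonoAnalyticType _ _ _ hΔ hq G,
    rmk1111_a_genuineOfModelIsm _ _ _ hΔ hq,
    rmk1111_d_genuineOfModelIsm _ _ _ hΔ hq,
    rmk181_genuineOfModelIsm _ _ _ hΔ hq,
    fun f => prop42i_genuineOfModelIsm _ _ _ hΔ hq f,
    fun G => prop34iiStrong_genuineOfModelIsm _ _ _ hΔ hq G,
    fun G _ _ act ιU hι => cor37ii_uniradialContent_genuineOfModelIsm _ _ _ hΔ hq G act ιU hι⟩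

/-! ### At the EXPLICIT producer (statements whose extra data are typed on the genuine units `(𝒪^⊳_{ℚ̄_p})ˣ`) -/

/-- **[IUTchII] Rmk. 1.11.1 (i) (b) at the Tate model, UNCONDITIONALLY**: `Rmk1111_b` with `zhatPow := zhatPowOunits` HOLDS at the
explicit all-fields-genuine producer `genuineOfModelIsm S mlfClosurePadic galoisEpsilonPadic hΔ hq` over `modelχq p i j`
(`hΔ`, `hq` the theorems of p489543; abc-iut-w6-d010's `rmk1111_b_genuineOfModelIsm`).
[claim: Mochizuki2012, status: disputed] (IUTchII §1 Rmk 1.11.1 (i), kurims p.50) -/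
theorem rmk1111_b_genuineOfModelIsm_modelχq :
    Rmk1111_b
      (genuineOfModelIsm (ThetaSetting.ofDoubleUnderline C μ hC hS hl hp2 hpl hζ hη)
        (Literature.AnabelianGeometry.EtaleTheta.ThetaSetting.modelχq p i j hj).toTemperedCurve.mlfClosurePadic (Literature.AnabelianGeometry.EtaleTheta.ThetaSetting.modelχq p i j hj).toTemperedCurve.galoisEpsilonPadic
        (deltaX_characteristic_ofDoubleUnderline_modelχq_of_ker_ne_bot' p i j hj C μ hC hS hl hp2 hpl hζ hη
          (ker_tatePairHom_ne_bot p i j))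
        (nonempty_quotDeltaX_iso_ofDoubleUnderline_modelχq p i j hj C μ hC hS hl hp2 hpl hζ hη))
      (fun _ => Genuine.zhatPowOunits (Literature.AnabelianGeometry.EtaleTheta.ThetaSetting.modelχq p i j hj).toTemperedCurve.mlfClosurePadic) :=
  Genuine.rmk1111_b_genuineOfModelIsm _ _ _ _ _

/-- **[IUTchII] Rmk. 1.11.2 (i) at the Tate model, UNCONDITIONALLY**: at the same explicit producer, for every `G`, `Rmk1112_i`
HOLDS with `zhatPow := zhatPowOunits`, `L := k̄ = ℚ̄_p` (additive), `toL :=` the `p`-adic logarithm on units, multiplication, and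
the action of `Ẑ^×` through the `p`-adic cyclotomic character (abc-iut-w6-d020's `rmk1112_i_genuineOfModelIsm`; the
residue-characteristic `Fact` is `MLFClosure.fact_residueChar_prime`). [claim: Mochizuki2012, status: disputed] (IUTchII §1 Rmk 1.11.2 (i), kurims pp.50-51) -/
theorem rmk1112_i_genuineOfModelIsm_modelχq
    [Fact (Literature.AnabelianGeometry.EtaleTheta.ThetaSetting.modelχq p i j hj).toTemperedCurve.mlfClosurePadic.residueChar.Prime]
    (G : IsoClass (ThetaSetting.ofDoubleUnderline C μ hC hS hl hp2 hpl hζ hη).Gk) :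
    Rmk1112_i
      (genuineOfModelIsm (ThetaSetting.ofDoubleUnderline C μ hC hS hl hp2 hpl hζ hη)
        (Literature.AnabelianGeometry.EtaleTheta.ThetaSetting.modelχq p i j hj).toTemperedCurve.mlfClosurePadic (Literature.AnabelianGeometry.EtaleTheta.ThetaSetting.modelχq p i j hj).toTemperedCurve.galoisEpsilonPadic
        (deltaX_characteristic_ofDoubleUnderline_modelχq_of_ker_ne_bot' p i j hj C μ hC hS hl hp2 hpl hζ hη
          (ker_tatePairHom_ne_bot p i j))
        (nonempty_quotDeltaX_iso_ofDoubleUnderline_modelχq p i j hj C μ hC hS hl hp2 hpl hζ hη))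
      G (Genuine.zhatPowOunits (Literature.AnabelianGeometry.EtaleTheta.ThetaSetting.modelχq p i j hj).toTemperedCurve.mlfClosurePadic) (Literature.AnabelianGeometry.EtaleTheta.ThetaSetting.modelχq p i j hj).toTemperedCurve.mlfClosurePadic.K
      (MonoidHom.toAdditiveLeft
        ((Literature.AnabelianGeometry.EtaleTheta.ThetaSetting.modelχq p i j hj).toTemperedCurve.mlfClosurePadic.galoisPadicLog.logHom.comp
          (Genuine.unitsBridge (Literature.AnabelianGeometry.EtaleTheta.ThetaSetting.modelχq p i j hj).toTemperedCurve.mlfClosurePadic).toMonoidHom))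
      (· * ·)
      (AddAut.mulLeft.comp
        ((Literature.AnabelianGeometry.EtaleTheta.ThetaSetting.modelχq p i j hj).toTemperedCurve.mlfClosurePadic.padicScalarUnits.comp
          (ZHatLevel.padicCharUnits (Literature.AnabelianGeometry.EtaleTheta.ThetaSetting.modelχq p i j hj).toTemperedCurve.mlfClosurePadic.residueChar))) :=
  Genuine.rmk1112_i_genuineOfModelIsm _ _ _ _ _ G

/-- The residue-characteristic `Fact` used above is a THEOREM of the closure datum (so `rmk1112_i_genuineOfModelIsm_modelχq` has
no residual hypothesis): instantiation at `MLFClosure.fact_residueChar_prime`. [claim: Mochizuki2012, status: disputed] (IUTchII §1 Rmk 1.11.2 (i), kurims pp.50-51) -/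
theorem rmk1112_i_genuineOfModelIsm_modelχq'
    (G : IsoClass (ThetaSetting.ofDoubleUnderline C μ hC hS hl hp2 hpl hζ hη).Gk) :
    haveI := (Literature.AnabelianGeometry.EtaleTheta.ThetaSetting.modelχq p i j hj).toTemperedCurve.mlfClosurePadic.fact_residueChar_prime
    Rmk1112_i
      (genuineOfModelIsm (ThetaSetting.ofDoubleUnderline C μ hC hS hl hp2 hpl hζ hη)
        (Literature.AnabelianGeometry.EtaleTheta.ThetaSetting.modelχq p i j hj).toTemperedCurve.mlfClosurePadic (Literature.AnabelianGeometry.EtaleTheta.ThetaSetting.modelχq p i j hj).toTemperedCurve.galoisEpsilonPadic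
        (deltaX_characteristic_ofDoubleUnderline_modelχq_of_ker_ne_bot' p i j hj C μ hC hS hl hp2 hpl hζ hη
          (ker_tatePairHom_ne_bot p i j))
        (nonempty_quotDeltaX_iso_ofDoubleUnderline_modelχq p i j hj C μ hC hS hl hp2 hpl hζ hη))
      G (Genuine.zhatPowOunits (Literature.AnabelianGeometry.EtaleTheta.ThetaSetting.modelχq p i j hj).toTemperedCurve.mlfClosurePadic) (Literature.AnabelianGeometry.EtaleTheta.ThetaSetting.modelχq p i j hj).toTemperedCurve.mlfClosurePadic.K
      (MonoidHom.toAdditiveLeft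
        ((Literature.AnabelianGeometry.EtaleTheta.ThetaSetting.modelχq p i j hj).toTemperedCurve.mlfClosurePadic.galoisPadicLog.logHom.comp
          (Genuine.unitsBridge (Literature.AnabelianGeometry.EtaleTheta.ThetaSetting.modelχq p i j hj).toTemperedCurve.mlfClosurePadic).toMonoidHom))
      (· * ·)
      (AddAut.mulLeft.comp
        ((Literature.AnabelianGeometry.EtaleTheta.ThetaSetting.modelχq p i j hj).toTemperedCurve.mlfClosurePadic.padicScalarUnits.comp
          (ZHatLevel.padicCharUnits (Literature.AnabelianGeometry.EtaleTheta.ThetaSetting.modelχq p i j hj).toTemperedCurve.mlfClosurePadic.residueChar))) := by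
  haveI := (Literature.AnabelianGeometry.EtaleTheta.ThetaSetting.modelχq p i j hj).toTemperedCurve.mlfClosurePadic.fact_residueChar_prime
  exact rmk1112_i_genuineOfModelIsm_modelχq p i j hj C μ hC hS hl hp2 hpl hζ hη G

end AbsTopMonoids

end Literature.IUT.HodgeArakelov

end
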